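/-
B2b (LevelGradedCohnUmans, decidable (m,k) = (2,1) cell) — gen 17.
**The `p = 31` residual: one profile.**

VALUE = THEOREM (a reduction at the one prime the order sieve leaves open), NOT summit progress;
the crux item `SubgroupIdentityDesigns` is untouched and remains open.
Report: `run/shared/lean/b2b/levelgraded-cu/ORACLE-g17.md` §G17-5 (S-g).
-/
import Mathlib
import Summits.MatrixMultiplication.MatrixMultiplication.Theorems.SubgroupIdentityDesigns.Negative.CellFive
import Summits.MatrixMultiplication.MatrixMultiplication.Theorems.SubgroupIdentityDesigns.Negative.MonomialRatio

/-!
# The `p = 31` residual of the `(2,1)` cell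

`OrderSieve.cellTwoOne_empty_of_ne_31` / `CellFive.cellTwoOne_empty_of_ne_31'` close the
`(2,1)` cell at every prime except `31`, where the arithmetic sieve has survivors
(`OrderSieve.sieveKill_31`).  Here the two Cartan image laws (`SingerFrobenius`,
`MonomialRatio`) sharpen the member numerology at `p = 31` (`p + 1 = 32 = 2^5`):

* `member_law_mersenne` — at a prime with `p + 1 = 2^k`, a `p`-free member `X` avoiding `-1`
  with `|X| ≥ p + 1` and scalar part `S_X` of order dividing `p - 1` is conjugate into the
  MONOMIAL group (the non-split type would force `|X| ≤ 2|S_X| ≤ p - 1`), and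
  `|X| = |S_X| · u` with `u ∣ p - 1` or `u = 2w`, `w` odd, `w ∣ p - 1`;
* `residualOK` / `residual31_all` — the kernel-evaluated decision over
  `N ∈ {12, 24, 60}` and `z_E, z_A, z_B, u_A, u_B ∣ 30` of all the Lean-available constraints
  (parity, scalar law, window, walls, floor): the ONLY survivor is
  `(N, z_E, u_A, u_B) = (60, 2, 30, 30)` with `{z_A, z_B} = {3, 5}`;
* `prime_eq_31_of_levelOne_witness` — a `(2,1)` witness forces `p = 31` (restates
  `CellFive.cellTwoOne_empty_of_ne_31'` positively);
* **`levelOne_witness_31_residual`** — hence a `(2,1)` witness at `p = 31` (`0 < ε ≤ 1`)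
  consists, up to the order of the factors, of an exceptional member `E ∋ -1` with
  `|E| = 120` and projective image of order `60`, and two members `A`, `B` conjugate into the
  monomial group with `(|A|, |S_A|) = (90, 3)` and `(|B|, |S_B|) = (150, 5)`.

This is exactly the profile `(120, 90, 150)` that the gen-16 exhaustive census (kit job
`j126482`, 45 720 TPP triples, all certificate-killed) covers as DATA; the Lean verdict at
`p = 31` therefore rests on that one profile.
-/

set_option linter.dupNamespace false

noncomputable section

open scoped Classical
open Summit.MatrixMultiplication.MatrixMultiplication.Theorems.LieRankDesigns.Negative (GLm Mat budget)
open Literature.Barriers.MatrixMultiplication (SubgroupTPP)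

namespace Summit.MatrixMultiplication.MatrixMultiplication.Theorems.SubgroupIdentityDesigns.Negative

section MemberLaw

variable {p : ℕ} [hp : Fact p.Prime]

/-- **Member law at a Mersenne-type prime** (`p + 1 = 2^k`, `p ≥ 3`): a `p`-free member `X`
with `-1 ∉ X`, `|X| ≥ p + 1` and `|S_X| ∣ p - 1` is conjugate into the monomial group, and
`|X| = |S_X| · u` with `u ∣ p - 1` or `u = 2w`, `w` odd, `w ∣ p - 1`. -/
theorem member_law_mersenne (hp3 : 3 ≤ p) {k : ℕ} (hk : p + 1 = 2 ^ k) {n : ZMod p}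
    (hn : ∀ x : ZMod p, x * x ≠ n) {X : Subgroup (GLm p 2)} (hXK : ¬ p ∣ Nat.card X)
    (hXneg : scalarHom p 2 (-1) ∉ X) (hwin : p + 1 ≤ Nat.card X)
    (hz : Nat.card (X.comap (scalarHom p 2)) ∣ p - 1) :
    (∃ g : GLm p 2, ∀ x ∈ X, IsMonomial (g * x * g⁻¹)) ∧
      ∃ u : ℕ, Nat.card X = Nat.card (X.comap (scalarHom p 2)) * u ∧
        (u ∣ p - 1 ∨ ∃ w : ℕ, u = 2 * w ∧ Odd w ∧ w ∣ p - 1) := by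
  have hp2 : p ≠ 2 := by omega
  rcases dickson_sharp hp2 hn hXK with ⟨g, hg⟩ | ⟨g, hg⟩ | ⟨hmem, -⟩
  · refine ⟨⟨g, hg⟩, ?_⟩
    obtain ⟨w, hw, h | ⟨hodd, h⟩⟩ := card_law_of_conj_monomial hg hXneg
    · exact ⟨w, h, Or.inl hw⟩
    · exact ⟨2 * w, h, Or.inr ⟨w, rfl, hodd, hw⟩⟩
  · exfalso
    have hle := card_le_two_mul_scalar_of_conj_singerNormal hp2 hk hn hg hXneg
    have hodd := not_two_dvd_card_comap_of_neg_one_not_mem hXneg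
    set z := Nat.card (X.comap (scalarHom p 2)) with hzdef
    have hpodd : p % 2 = 1 := Nat.odd_iff.mp (hp.out.odd_of_ne_two hp2)
    obtain ⟨c, hc⟩ := hz
    have hc1 : c ≠ 1 := by
      rintro rfl
      rw [mul_one] at hc
      apply hodd
      rw [← hc]
      omega
    have hc0 : c ≠ 0 := by
      rintro rfl
      rw [mul_zero] at hc
      omega
    have h2z : 2 * z ≤ p - 1 := by
      have hc2 : 2 ≤ c := by omega
      calc 2 * z = z * 2 := by ring
        _ ≤ z * c := Nat.mul_le_mul_left z hc2
        _ = p - 1 := hc.symm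
    omega
  · exact absurd hmem hXneg

end MemberLaw

/-! ## The kernel-evaluated decision at `p = 31` -/

section Decision

/-- One candidate `(N, z_E, z_A, z_B, u_A, u_B)` at `p = 31`: `true` means the candidate violates
a constraint OR is the surviving profile `(60, 2, {3,5}, 30, 30)`. -/
def residualOK (N zE zA zB uA uB : ℕ) : Bool :=
  !decide (N ∣ (31 - 1) * (31 + 1)) || !decide (2 ∣ zE) || !decide (zE * zA * zB ∣ 31 - 1) ||
    !decide (Nat.Coprime zE zA) || !decide (Nat.Coprime zE zB) || !decide (Nat.Coprime zA zB) ||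
    !decide (zE * N ≤ 31 ^ 2 - 3) || !decide (31 + 1 ≤ zA * uA) || !decide (31 + 1 ≤ zB * uB) ||
    !decide (zE * N * (zA * uA) + 2 * 31 ≤ (31 + 1) * (31 ^ 2 - 1)) ||
    !decide (zE * N * (zB * uB) + 2 * 31 ≤ (31 + 1) * (31 ^ 2 - 1)) ||
    !decide (zA * uA * (zB * uB) + 2 * 31 ≤ (31 + 1) * (31 ^ 2 - 1)) ||
    !decide (1 + 31 ^ 3 + (31 - 2) * (31 + 1) ^ 3 < zE * N * (zA * uA) * (zB * uB)) ||
    decide (N = 60 ∧ zE = 2 ∧ uA = 30 ∧ uB = 30 ∧ ((zA = 3 ∧ zB = 5) ∨ (zA = 5 ∧ zB = 3)))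

/-- **The decision**: every candidate over `N ∈ {12,24,60}` and divisors of `30` passes
`residualOK` (kernel evaluation, `3 · 8⁵` candidates). -/
theorem residual31_all :
    ([12, 24, 60].all fun N => (divList 31).all fun zE => (divList 31).all fun zA =>
      (divList 31).all fun zB => (divList 31).all fun uA => (divList 31).all fun uB =>
        residualOK N zE zA zB uA uB) = true := by
  decide +kernel

/-- Reading off one candidate from `residual31_all`. -/
theorem residualOK_of_mem {N zE zA zB uA uB : ℕ} (hN : N ∈ [12, 24, 60])
    (hzE : zE ∈ divList 31) (hzA : zA ∈ divList 31) (hzB : zB ∈ divList 31)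
    (huA : uA ∈ divList 31) (huB : uB ∈ divList 31) :
    residualOK N zE zA zB uA uB = true := by
  have h := residual31_all
  rw [List.all_eq_true] at h
  have h1 := h N hN
  rw [List.all_eq_true] at h1
  have h2 := h1 zE hzE
  rw [List.all_eq_true] at h2
  have h3 := h2 zA hzA
  rw [List.all_eq_true] at h3
  have h4 := h3 zB hzB
  rw [List.all_eq_true] at h4
  have h5 := h4 uA huA
  rw [List.all_eq_true] at h5
  exact h5 uB huB

/-- An image value `u` of the member law at `p = 31` divides `30`. -/
theorem mem_divList_31_of_law {u : ℕ} (hu : u ∣ 31 - 1 ∨ ∃ w : ℕ, u = 2 * w ∧ Odd w ∧ w ∣ 31 - 1) :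
    u ∈ divList 31 := by
  rcases hu with hu | ⟨w, rfl, hodd, hw⟩
  · exact mem_divList (by norm_num) hu
  · have hw30 : w ≤ 30 := Nat.le_of_dvd (by norm_num) hw
    interval_cases w <;>
      first | exact absurd hodd (by decide) | exact absurd hw (by decide) | decide

end Decision

/-! ## The residual theorem -/

section AnyPrime

variable {p : ℕ} [hp : Fact p.Prime]

/-- **A `(2,1)` witness lives at `p = 31`** (`0 < ε ≤ 1`): positive restatement of
`cellTwoOne_empty_of_ne_31'`. -/
theorem prime_eq_31_of_levelOne_witness {ε : ℝ} (hε : 0 < ε) (hε1 : ε ≤ 1)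
    {H₁ H₂ H₃ : Subgroup (GLm p 2)} (htpp : SubgroupTPP H₁ H₂ H₃)
    (hdesign : ∃ c : Mat p 2 → ℂ, (∀ M, 1 < M.rank → c M = 0) ∧
      (∑ M, c M * ZMod.stdAddChar (Matrix.trace (M * ((1 : GLm p 2) : Mat p 2)))) = 1 ∧
      ∀ a ∈ H₁, ∀ b ∈ H₂, ∀ g ∈ H₃, a * b * g ≠ 1 →
        (∑ M, c M *
          ZMod.stdAddChar (Matrix.trace (M * ((a * b * g : GLm p 2) : Mat p 2)))) = 0)
    (hwit : budget p 2 1 (2 + ε) <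
      ((Nat.card H₁ * Nat.card H₂ * Nat.card H₃ : ℕ) : ℝ) ^ ((2 + ε) / 3)) : p = 31 := by
  by_contra h31
  exact cellTwoOne_empty_of_ne_31' h31 hε hε1 htpp hdesign hwit

end AnyPrime

section Residual

variable [h31 : Fact (Nat.Prime 31)]

/-- Core of the residual: the numerology of an ordered member triple `(E, A, B)` at `p = 31`. -/
theorem residual_core {n : ZMod 31} (hn : ∀ x : ZMod 31, x * x ≠ n)
    {E A B : Subgroup (GLm 31 2)} (hAK : ¬ 31 ∣ Nat.card A) (hBK : ¬ 31 ∣ Nat.card B)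
    (hAneg : scalarHom 31 2 (-1) ∉ A) (hBneg : scalarHom 31 2 (-1) ∉ B)
    (hmem : scalarHom 31 2 (-1) ∈ E) {N : ℕ} (hN : N = 12 ∨ N = 24 ∨ N = 60)
    (hNd : N ∣ (31 - 1) * (31 + 1))
    (hcard : Nat.card E = Nat.card (E.comap (scalarHom 31 2)) * N)
    (hEA : Nat.Coprime (Nat.card (E.comap (scalarHom 31 2))) (Nat.card (A.comap (scalarHom 31 2))))
    (hEB : Nat.Coprime (Nat.card (E.comap (scalarHom 31 2))) (Nat.card (B.comap (scalarHom 31 2))))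
    (hAB : Nat.Coprime (Nat.card (A.comap (scalarHom 31 2))) (Nat.card (B.comap (scalarHom 31 2))))
    (hprod : Nat.card (E.comap (scalarHom 31 2)) * Nat.card (A.comap (scalarHom 31 2)) *
      Nat.card (B.comap (scalarHom 31 2)) ∣ 31 - 1)
    (hwinE : Nat.card E ≤ 31 ^ 2 - 3) (hwinA : 31 + 1 ≤ Nat.card A) (hwinB : 31 + 1 ≤ Nat.card B)
    (hwEA : Nat.card E * Nat.card A + 2 * 31 ≤ (31 + 1) * (31 ^ 2 - 1))
    (hwEB : Nat.card E * Nat.card B + 2 * 31 ≤ (31 + 1) * (31 ^ 2 - 1))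
    (hwAB : Nat.card A * Nat.card B + 2 * 31 ≤ (31 + 1) * (31 ^ 2 - 1))
    (hfloor : 1 + 31 ^ 3 + (31 - 2) * (31 + 1) ^ 3 < Nat.card E * Nat.card A * Nat.card B) :
    N = 60 ∧ Nat.card E = 120 ∧
      (∃ g : GLm 31 2, ∀ x ∈ A, IsMonomial (g * x * g⁻¹)) ∧
      (∃ g : GLm 31 2, ∀ x ∈ B, IsMonomial (g * x * g⁻¹)) ∧
      ((Nat.card A = 90 ∧ Nat.card (A.comap (scalarHom 31 2)) = 3 ∧
          Nat.card B = 150 ∧ Nat.card (B.comap (scalarHom 31 2)) = 5) ∨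
        (Nat.card A = 150 ∧ Nat.card (A.comap (scalarHom 31 2)) = 5 ∧
          Nat.card B = 90 ∧ Nat.card (B.comap (scalarHom 31 2)) = 3)) := by
  have hp3 : 3 ≤ 31 := by norm_num
  have hk : 31 + 1 = 2 ^ 5 := by norm_num
  set zE := Nat.card (E.comap (scalarHom 31 2)) with hzE
  set zA := Nat.card (A.comap (scalarHom 31 2)) with hzA
  set zB := Nat.card (B.comap (scalarHom 31 2)) with hzB
  have hzAd : zA ∣ 31 - 1 :=
    Dvd.dvd.trans (Dvd.intro_left _ rfl) (Dvd.dvd.trans (Dvd.intro _ rfl) hprod)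
  have hzBd : zB ∣ 31 - 1 := Dvd.dvd.trans (Dvd.intro_left _ rfl) hprod
  have hzEd : zE ∣ 31 - 1 :=
    Dvd.dvd.trans (Dvd.intro _ rfl) (Dvd.dvd.trans (Dvd.intro _ rfl) hprod)
  obtain ⟨hAmono, uA, hAcard, huA⟩ := member_law_mersenne hp3 hk hn hAK hAneg hwinA hzAd
  obtain ⟨hBmono, uB, hBcard, huB⟩ := member_law_mersenne hp3 hk hn hBK hBneg hwinB hzBd
  have hNmem : N ∈ [12, 24, 60] := by
    rcases hN with rfl | rfl | rfl <;> simp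
  have hq := residualOK_of_mem hNmem (mem_divList (by norm_num) hzEd)
    (mem_divList (by norm_num) hzAd) (mem_divList (by norm_num) hzBd)
    (mem_divList_31_of_law huA) (mem_divList_31_of_law huB)
  have h2 : 2 ∣ zE := two_dvd_card_comap_of_neg_one_mem (by norm_num) hmem
  rw [hcard] at hwinE hwEA hwEB hfloor
  rw [hAcard] at hwinA hwEA hwAB hfloor
  rw [hBcard] at hwinB hwEB hwAB hfloor
  simp only [residualOK, Bool.or_eq_true, Bool.not_eq_true', decide_eq_false_iff_not,
    decide_eq_true_eq] at hq
  rcases hq with ((((((((((((hq | hq) | hq) | hq) | hq) | hq) | hq) | hq) | hq) | hq) | hq) |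
      hq) | hq) | hq
  · exact absurd hNd hq
  · exact absurd h2 hq
  · exact absurd hprod hq
  · exact absurd hEA hq
  · exact absurd hEB hq
  · exact absurd hAB hq
  · exact absurd hwinE hq
  · exact absurd hwinA hq
  · exact absurd hwinB hq
  · exact absurd hwEA hq
  · exact absurd hwEB hq
  · exact absurd hwAB hq
  · exact absurd hfloor hq
  · obtain ⟨hN60, hzE2, huA30, huB30, hz⟩ := hq
    refine ⟨hN60, ?_, hAmono, hBmono, ?_⟩
    · rw [hcard, hzE2, hN60]
    · rcases hz with ⟨hzA3, hzB5⟩ | ⟨hzA5, hzB3⟩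
      · left
        refine ⟨?_, hzA3, ?_, hzB5⟩
        · rw [hAcard, ← hzA, hzA3, huA30]
        · rw [hBcard, ← hzB, hzB5, huB30]
      · right
        refine ⟨?_, hzA5, ?_, hzB3⟩
        · rw [hAcard, ← hzA, hzA5, huA30]
        · rw [hBcard, ← hzB, hzB3, huB30]

/-- **The `p = 31` residual.**  A `(2,1)` witness at `p = 31` (`0 < ε ≤ 1`) is, up to the order
of its factors, `(E, A, B)` with `-1 ∈ E`, `|E| = 120`, projective image of `E` of order `60`,
and `A`, `B` conjugate into the monomial group with `(|A|, |S_A|; |B|, |S_B|) = (90, 3; 150, 5)`.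
(The one profile the gen-16 census covers as data.)  NOT summit progress. -/
theorem levelOne_witness_31_residual {ε : ℝ} (hε : 0 < ε) (hε1 : ε ≤ 1)
    {H₁ H₂ H₃ : Subgroup (GLm 31 2)} (htpp : SubgroupTPP H₁ H₂ H₃)
    (hdesign : ∃ c : Mat 31 2 → ℂ, (∀ M, 1 < M.rank → c M = 0) ∧
      (∑ M, c M * ZMod.stdAddChar (Matrix.trace (M * ((1 : GLm 31 2) : Mat 31 2)))) = 1 ∧
      ∀ a ∈ H₁, ∀ b ∈ H₂, ∀ g ∈ H₃, a * b * g ≠ 1 →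
        (∑ M, c M *
          ZMod.stdAddChar (Matrix.trace (M * ((a * b * g : GLm 31 2) : Mat 31 2)))) = 0)
    (hwit : budget 31 2 1 (2 + ε) <
      ((Nat.card H₁ * Nat.card H₂ * Nat.card H₃ : ℕ) : ℝ) ^ ((2 + ε) / 3)) :
    ∃ E A B : Subgroup (GLm 31 2),
      ((E = H₁ ∧ A = H₂ ∧ B = H₃) ∨ (E = H₂ ∧ A = H₁ ∧ B = H₃) ∨ (E = H₃ ∧ A = H₁ ∧ B = H₂)) ∧
      scalarHom 31 2 (-1) ∈ E ∧ Nat.card E = 120 ∧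
      Nat.card (E.map (QuotientGroup.mk' (scalarHom 31 2).range)) = 60 ∧
      (∃ g : GLm 31 2, ∀ x ∈ A, IsMonomial (g * x * g⁻¹)) ∧
      (∃ g : GLm 31 2, ∀ x ∈ B, IsMonomial (g * x * g⁻¹)) ∧
      ((Nat.card A = 90 ∧ Nat.card (A.comap (scalarHom 31 2)) = 3 ∧
          Nat.card B = 150 ∧ Nat.card (B.comap (scalarHom 31 2)) = 5) ∨
        (Nat.card A = 150 ∧ Nat.card (A.comap (scalarHom 31 2)) = 5 ∧
          Nat.card B = 90 ∧ Nat.card (B.comap (scalarHom 31 2)) = 3)) := by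
  have hp7 : 7 ≤ 31 := by norm_num
  have hp2 : (31 : ℕ) ≠ 2 := by norm_num
  have hp3 : 3 ≤ 31 := by norm_num
  obtain ⟨n, hn⟩ := FiniteField.exists_nonsquare (F := ZMod 31) (by
    rw [ZMod.ringChar_zmod_n]; norm_num)
  have hn' : ∀ x : ZMod 31, x * x ≠ n := fun x hx => hn ⟨x, hx.symm⟩
  obtain ⟨-, hK₁, hK₂, hK₃⟩ := levelOne_witness_pfree_profile hp3 hε hε1 htpp hdesign hwit
  obtain ⟨h12, h13, h23⟩ := neg_one_mem_atMostOne hp2 htpp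
  obtain ⟨c₁₂, c₁₃, c₂₃, hprod⟩ := scalar_law htpp
  obtain ⟨⟨hlo₁, hhi₁⟩, ⟨hlo₂, hhi₂⟩, ⟨hlo₃, hhi₃⟩⟩ :=
    levelOne_witness_window hp3 (by linarith) hε1 htpp hdesign hwit
  have hwalls : ¬ ((31 + 1) * (31 ^ 2 - 1) < Nat.card H₁ * Nat.card H₃ + 2 * 31 ∨
      (31 + 1) * (31 ^ 2 - 1) < Nat.card H₁ * Nat.card H₂ + 2 * 31 ∨
      (31 + 1) * (31 ^ 2 - 1) < Nat.card H₂ * Nat.card H₃ + 2 * 31) :=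
    fun h => StandardLines.no_levelOne_design_of_walls H₁ H₂ H₃ htpp h hdesign
  push Not at hwalls
  obtain ⟨hw₁₃, hw₁₂, hw₂₃⟩ := hwalls
  have hfloor : 1 + 31 ^ 3 + (31 - 2) * (31 + 1) ^ 3 <
      Nat.card H₁ * Nat.card H₂ * Nat.card H₃ := by
    by_contra hle
    exact no_levelOne_witness_of_volume_le_nat (by linarith) hε1 (Nat.le_of_not_lt hle) hwit
  obtain ⟨H, hH, hmem, N, hN, hdvd, hcard, himg⟩ :=
    levelOne_witness_exceptional_member hp7 hn' hε hε1 htpp hdesign hwit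
  rcases hH with rfl | rfl | rfl
  · obtain ⟨hN60, hE, hAm, hBm, hrest⟩ := residual_core hn' hK₂ hK₃
      (fun h => h12 ⟨hmem, h⟩) (fun h => h13 ⟨hmem, h⟩) hmem hN hdvd hcard c₁₂ c₁₃ c₂₃ hprod
      hhi₁ hlo₂ hlo₃ hw₁₂ hw₁₃ hw₂₃ hfloor
    exact ⟨H, H₂, H₃, Or.inl ⟨rfl, rfl, rfl⟩, hmem, hE, hN60 ▸ himg, hAm, hBm, hrest⟩
  · obtain ⟨hN60, hE, hAm, hBm, hrest⟩ := residual_core hn' hK₁ hK₃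
      (fun h => h12 ⟨h, hmem⟩) (fun h => h23 ⟨hmem, h⟩) hmem hN hdvd hcard c₁₂.symm c₂₃ c₁₃
      (by simpa only [mul_comm, mul_left_comm, mul_assoc] using hprod)
      hhi₂ hlo₁ hlo₃ (by rwa [mul_comm (Nat.card H)]) hw₂₃ hw₁₃
      (by simpa only [mul_comm, mul_left_comm, mul_assoc] using hfloor)
    exact ⟨H, H₁, H₃, Or.inr (Or.inl ⟨rfl, rfl, rfl⟩), hmem, hE, hN60 ▸ himg, hAm, hBm, hrest⟩
  · obtain ⟨hN60, hE, hAm, hBm, hrest⟩ := residual_core hn' hK₁ hK₂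
      (fun h => h13 ⟨h, hmem⟩) (fun h => h23 ⟨h, hmem⟩) hmem hN hdvd hcard c₁₃.symm c₂₃.symm c₁₂
      (by simpa only [mul_comm, mul_left_comm, mul_assoc] using hprod)
      hhi₃ hlo₁ hlo₂ (by rwa [mul_comm (Nat.card H)]) (by rwa [mul_comm (Nat.card H)]) hw₁₂
      (by simpa only [mul_comm, mul_left_comm, mul_assoc] using hfloor)
    exact ⟨H, H₁, H₂, Or.inr (Or.inr ⟨rfl, rfl, rfl⟩), hmem, hE, hN60 ▸ himg, hAm, hBm, hrest⟩

end Residual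

end Summit.MatrixMultiplication.MatrixMultiplication.Theorems.SubgroupIdentityDesigns.Negative

end
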